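import Summits.HodgeConjecture.HodgeConjecture.Cruxes.BlochSeedDiscOne.SlotLatticeLaw

/-!
# The COMPLETE CHARGE LATTICE of integer (A1)-clean designs at even height (strengthen g13, S⁺ ledger rows #140–#144)

The OPTIMAL integrality law of PHASE-TORUS type for the slot-resolved letter model of `DepthBoundA4.lean` — the S⁺ whose step is a
finite letter calculus, now carried to its end.  For an INTEGER design `D` on the height-`h` alphabet, `h` even, write
`q_d = T(D)(w)` for the e-free words of degree `d` (all placements agree by (A1).2) and `μ = T(eeee)`.  Then

  `q₁ ∈ 2ℤ, q₂ ∈ 4ℤ, q₃ ∈ 8ℤ, q₄ ∈ 8ℤ, q₅ ∈ 16ℤ, q₆ ∈ 16ℤ, q₇ ∈ 16ℤ, q₈ ∈ 16ℤ,  Re μ ≡ Im μ ≡ 2·q₄ (mod 32)`   (`ChargeLattice h`),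

hence `μ ∈ 16ℤ[i]`, `Re μ ≡ Im μ (mod 32)`, `|μ|² ≥ 512` whenever `μ ≠ 0`, and the PARITY COUPLING `q₄/8 ≡ Re μ/16 ≡ Im μ/16 (mod 2)`:
`μ = 0 ⇒ q₄ ∈ 16ℤ`, and a design with `q₄ ≡ 8 (mod 16)` has `μ ≠ 0` (`mu_ne_zero_of_q4`); if `Re μ = 0` (every design of record) then `32 ∣ Im μ`
(`mu_law_of_re_zero`): the MINMU record `μ = ±32i` is optimal among purely-imaginary Bloch charges.  This sharpens `SlotLatticeLaw` (`q_d ∈ 2^⌈d/2⌉ℤ`) in degrees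
2–6 and `TwoAdicMuLaw` (`4 ∣ μ`) by two powers of `1+i`, and it is COMPLETE: the achievable charge vectors `(rank, q₁,…,q₈, Re μ, Im μ)`
of integer (A1)-designs on the full height-`h` alphabet (`h = 2,4,6,8,14,16` computed) are EXACTLY this lattice, of index `2³⁵` in `ℤ¹¹`,
elementary divisors `1,2,4,8,8,16,16,16,16,32,32` (exact computation `memo-20/eng/chargelattice.py`: the moment map `ℓ ↦ (1,a,n,x,y)` has image
lattice `Λ₁ = {n even, a+x+y even}` of index 4, designs are the tensors of `Λ₁^{⊗4}` satisfying the linear (A1) conditions, and the lattice is read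
off against the dual basis `(Λ₁^*)^{⊗4}`; completeness = every lattice vector is the charge vector of some integer (A1)-design).

PROOF (the half-charge calculus).  On a letter of even height the SLOT FACTOR `σ = 2·h + (1+i)·e + (1−i)·ē` evaluates to
`2a + (1+i)β̄ + (1−i)β = 2(a + x + y) ∈ 4ℤ`, and `n ∈ 2ℤ`.  The level functional `Φ_k(w) = T(σ^{⊗k} ⊗ w_{≥k})` obeys the three-term recursion
`Φ_{k+1}(w) = 2Φ_k(h·w) + (1+i)Φ_k(e·w) + (1−i)Φ_k(ē·w)`; (A1).1 kills every e-mixed word, so `Φ_k(1…) = 2^k q_k`, `Φ_k(p^j…) = 2^k q_{k+2j}`,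
and `Φ₄ = 16 q₄ + (1+i)⁴ μ + (1−i)⁴ μ̄ = 16 q₄ − 8 Re μ` (with `σ' = 2h + (1−i)e + (1+i)ē` on the last factor: `16 q₄ − 8 Im μ`), while cell by
cell `Φ_k(p^j…)` is an integer divisible by `4^k 2^j`.  Hence `q_{k+2j} ∈ 2^{k+j}ℤ` (`k ≤ 3`, `k + j ≤ 4`) and `16 q₄ − 8 Re μ, 16 q₄ − 8 Im μ ∈ 256ℤ`.

STATUS WORD: a kernel theorem about the LETTER model (evidence-grade bookkeeping; letters ≠ sheaves ≠ SEED); nothing here is a step toward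
HC ∕ HC_CM ∕ HC_AV ∕ №4 ∕ 26512 ∕ 18881 ∕ H2.  USE: the lift test for the node's multiset class model — an integer class point `z` of
`ClassModel(6,8,199)` lifts to a slot-resolved integer design only if its orbit-summed rows satisfy `S_W(z) = |WC[W]|·q_d` with `(q, μ)` in
this lattice (memo-20 §3: the corrected side constraints (P-CL) for the node's MILP; the 14 published class points already fail the degree-1 row,
`SlotLatticeLaw.no_design_has_levelSum_746`).
-/

namespace Summit.HodgeConjecture.HodgeConjecture.Cruxes.BlochSeedDiscOne.ChargeLatticeLaw

open Summit.HodgeConjecture.HodgeConjecture.Cruxes.BlochSeedDiscOne.DepthBoundA4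
open Summit.HodgeConjecture.HodgeConjecture.Cruxes.BlochSeedDiscOne.TwoAdicMuLaw
open Summit.HodgeConjecture.HodgeConjecture.Cruxes.BlochSeedDiscOne.SlotLatticeLaw

/-! ## §1 Words by symbols and the (A1).1 zero test -/

/-- The word with symbols `s₀ s₁ s₂ s₃`. -/
def W (s0 s1 s2 s3 : Sym) : Word := ![s0, s1, s2, s3]

theorem W_eeee : W .e .e .e .e = Word.eeee := by
  funext f; fin_cases f <;> rfl
theorem W_EEEE : W .ebar .ebar .ebar .ebar = Word.EEEE := by
  funext f; fin_cases f <;> rfl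
theorem T_eeee (D : Design) : D.T Word.eeee = D.mu := rfl

theorem cellCoef_W (c : Cell) (s0 s1 s2 s3 : Sym) :
    cellCoef c (W s0 s1 s2 s3) = s0.coef (c 0) * s1.coef (c 1) * s2.coef (c 2) * s3.coef (c 3) := by
  unfold cellCoef W; simp [Fin.prod_univ_four]

/-- (A1).1 as a hypothesis: every e-mixed word other than `eeee` ∕ `ēēēē` has `T = 0`. -/
def ZT (D : Design) : Prop := ∀ w : Word, ¬ w.efree → w ≠ Word.eeee → w ≠ Word.EEEE → D.T w = 0

theorem zt_of_A1 (D : Design) (h1 : D.A1) : ZT D := h1.1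

/-- Boolean test «`s₀s₁s₂s₃` is e-mixed»: some symbol is `e`/`ē`, and the word is neither `eeee` nor `ēēēē`. -/
def mixedB (s0 s1 s2 s3 : Sym) : Bool :=
  (!(s0.efree && s1.efree && s2.efree && s3.efree)) &&
  (!(decide (s0 = Sym.e) && decide (s1 = Sym.e) && decide (s2 = Sym.e) && decide (s3 = Sym.e))) &&
  (!(decide (s0 = Sym.ebar) && decide (s1 = Sym.ebar) && decide (s2 = Sym.ebar) && decide (s3 = Sym.ebar)))

/-- The zero test: a word passing `mixedB` vanishes under (A1).1. -/
theorem T0 (D : Design) (hz : ZT D) (s0 s1 s2 s3 : Sym) (hm : mixedB s0 s1 s2 s3 = true) : D.T (W s0 s1 s2 s3) = 0 := by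
  apply hz
  · intro hf
    have h0 := hf 0; have h1 := hf 1; have h2 := hf 2; have h3 := hf 3
    simp [W] at h0 h1 h2 h3
    simp [mixedB, h0, h1, h2, h3] at hm
  · intro he
    have h0 := congrFun he 0; have h1 := congrFun he 1; have h2 := congrFun he 2; have h3 := congrFun he 3
    simp [W, Word.eeee] at h0 h1 h2 h3
    subst h0; subst h1; subst h2; subst h3
    simp [mixedB] at hm
  · intro he
    have h0 := congrFun he 0; have h1 := congrFun he 1; have h2 := congrFun he 2; have h3 := congrFun he 3
    simp [W, Word.EEEE] at h0 h1 h2 h3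
    subst h0; subst h1; subst h2; subst h3
    simp [mixedB] at hm

/-! ## §2 The slot factors `σ = 2h + (1+i)e + (1−i)ē` and `σ' = 2h + (1−i)e + (1+i)ē` -/

/-- `π̄ = 1 − i`. -/
def piC : GaussianInt := ⟨1, -1⟩

/-- The half-charge `a + x + y` (even at even height) and its dual `a + x − y`. -/
def hs (ℓ : Letter) : ℤ := ℓ.a + ℓ.x + ℓ.y
/-- `a + x − y`. -/
def hd (ℓ : Letter) : ℤ := ℓ.a + ℓ.x - ℓ.y

/-- `σ(ℓ) = 2·a + (1+i)·β̄ + (1−i)·β`. -/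
def sg (ℓ : Letter) : GaussianInt := 2 * Sym.h.coef ℓ + piG * Sym.e.coef ℓ + piC * Sym.ebar.coef ℓ
/-- `σ'(ℓ) = 2·a + (1−i)·β̄ + (1+i)·β`. -/
def sd (ℓ : Letter) : GaussianInt := 2 * Sym.h.coef ℓ + piC * Sym.e.coef ℓ + piG * Sym.ebar.coef ℓ

theorem sg_eq (ℓ : Letter) : sg ℓ = ((2 * hs ℓ : ℤ) : GaussianInt) := by
  rw [Zsqrtd.ext_iff]
  refine ⟨?_, ?_⟩ <;> simp [sg, hs, piG, piC, Sym.coef, Letter.beta] <;> ring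

theorem sd_eq (ℓ : Letter) : sd ℓ = ((2 * hd ℓ : ℤ) : GaussianInt) := by
  rw [Zsqrtd.ext_iff]
  refine ⟨?_, ?_⟩ <;> simp [sd, hd, piG, piC, Sym.coef, Letter.beta] <;> ring

theorem two_dvd_hs (h : ℤ) (hh : (2 : ℤ) ∣ h) (ℓ : Letter) (hℓ : ℓ.OnAlphabet h) : (2 : ℤ) ∣ hs ℓ := by
  obtain ⟨k, hk⟩ := letter_parity h ℓ hℓ
  obtain ⟨m, hm⟩ := hh
  exact ⟨k + m, by unfold hs; linarith⟩

theorem two_dvd_hd (h : ℤ) (hh : (2 : ℤ) ∣ h) (ℓ : Letter) (hℓ : ℓ.OnAlphabet h) : (2 : ℤ) ∣ hd ℓ := by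
  obtain ⟨k, hk⟩ := two_dvd_hs h hh ℓ hℓ
  exact ⟨k - ℓ.y, by unfold hd; unfold hs at hk; linarith⟩

theorem four_dvd_two_hs (h : ℤ) (hh : (2 : ℤ) ∣ h) (ℓ : Letter) (hℓ : ℓ.OnAlphabet h) : (4 : ℤ) ∣ 2 * hs ℓ := by
  have e : (4 : ℤ) = 2 * 2 := by norm_num
  rw [e]; exact mul_dvd_mul_left 2 (two_dvd_hs h hh ℓ hℓ)

theorem four_dvd_two_hd (h : ℤ) (hh : (2 : ℤ) ∣ h) (ℓ : Letter) (hℓ : ℓ.OnAlphabet h) : (4 : ℤ) ∣ 2 * hd ℓ := by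
  have e : (4 : ℤ) = 2 * 2 := by norm_num
  rw [e]; exact mul_dvd_mul_left 2 (two_dvd_hd h hh ℓ hℓ)

/-! ## §3 The level functionals `Φ_k` and their three-term recursion -/

/-- Level-1 cell function `σ₀ · s₁ s₂ s₃`. -/
def L1 (s1 s2 s3 : Sym) (c : Cell) : GaussianInt := sg (c 0) * (s1.coef (c 1) * s2.coef (c 2) * s3.coef (c 3))
/-- Level-2 cell function `σ₀ σ₁ · s₂ s₃`. -/
def L2 (s2 s3 : Sym) (c : Cell) : GaussianInt := sg (c 0) * sg (c 1) * (s2.coef (c 2) * s3.coef (c 3))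
/-- Level-3 cell function `σ₀ σ₁ σ₂ · s₃`. -/
def L3 (s3 : Sym) (c : Cell) : GaussianInt := sg (c 0) * sg (c 1) * sg (c 2) * s3.coef (c 3)
/-- Level-4 cell function `σ₀ σ₁ σ₂ σ₃`. -/
def L4 (c : Cell) : GaussianInt := sg (c 0) * sg (c 1) * sg (c 2) * sg (c 3)
/-- Dual level-4 cell function `σ₀ σ₁ σ₂ σ'₃`. -/
def L4d (c : Cell) : GaussianInt := sg (c 0) * sg (c 1) * sg (c 2) * sd (c 3)

theorem L1_expand (s1 s2 s3 : Sym) (c : Cell) : L1 s1 s2 s3 c =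
    2 * cellCoef c (W .h s1 s2 s3) + piG * cellCoef c (W .e s1 s2 s3) + piC * cellCoef c (W .ebar s1 s2 s3) := by
  simp only [cellCoef_W]; unfold L1 sg; ring
theorem L2_expand (s2 s3 : Sym) (c : Cell) : L2 s2 s3 c = 2 * L1 .h s2 s3 c + piG * L1 .e s2 s3 c + piC * L1 .ebar s2 s3 c := by
  unfold L2 L1 sg; ring
theorem L3_expand (s3 : Sym) (c : Cell) : L3 s3 c = 2 * L2 .h s3 c + piG * L2 .e s3 c + piC * L2 .ebar s3 c := by
  unfold L3 L2 sg; ring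
theorem L4_expand (c : Cell) : L4 c = 2 * L3 .h c + piG * L3 .e c + piC * L3 .ebar c := by
  unfold L4 L3 sg; ring
theorem L4d_expand (c : Cell) : L4d c = 2 * L3 .h c + piC * L3 .e c + piG * L3 .ebar c := by
  unfold L4d L3 sg sd; ring

/-- three-term linearity of the weighted sums and of `Tf`. -/
theorem wsum_lin3 (L : List (Cell × ℕ)) (a b g : GaussianInt) (u v w : Cell → GaussianInt) :
    wsum L (fun c => a * u c + b * v c + g * w c) = a * wsum L u + b * wsum L v + g * wsum L w := by
  induction L with
  | nil => simp [wsum]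
  | cons x t ih =>
    simp only [wsum, List.map_cons, List.sum_cons] at ih ⊢
    rw [ih]; ring

theorem Tf_lin3 (D : Design) (a b g : GaussianInt) (u v w : Cell → GaussianInt) :
    Tf D (fun c => a * u c + b * v c + g * w c) = a * Tf D u + b * Tf D v + g * Tf D w := by
  unfold Tf; rw [wsum_lin3, wsum_lin3]; ring

/-- The level functionals. -/
def Φ1 (D : Design) (s1 s2 s3 : Sym) : GaussianInt := Tf D (L1 s1 s2 s3)
/-- `Φ₂`. -/
def Φ2 (D : Design) (s2 s3 : Sym) : GaussianInt := Tf D (L2 s2 s3)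
/-- `Φ₃`. -/
def Φ3 (D : Design) (s3 : Sym) : GaussianInt := Tf D (L3 s3)
/-- `Φ₄`. -/
def Φ4 (D : Design) : GaussianInt := Tf D L4
/-- `Φ₄'`. -/
def Φ4d (D : Design) : GaussianInt := Tf D L4d

theorem Φ1_expand (D : Design) (s1 s2 s3 : Sym) : Φ1 D s1 s2 s3 =
    2 * D.T (W .h s1 s2 s3) + piG * D.T (W .e s1 s2 s3) + piC * D.T (W .ebar s1 s2 s3) := by
  have e : L1 s1 s2 s3 = fun c =>
      2 * cellCoef c (W .h s1 s2 s3) + piG * cellCoef c (W .e s1 s2 s3) + piC * cellCoef c (W .ebar s1 s2 s3) :=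
    funext (L1_expand s1 s2 s3)
  unfold Φ1; rw [e, Tf_lin3]; rfl
theorem Φ2_expand (D : Design) (s2 s3 : Sym) : Φ2 D s2 s3 = 2 * Φ1 D .h s2 s3 + piG * Φ1 D .e s2 s3 + piC * Φ1 D .ebar s2 s3 := by
  have e : L2 s2 s3 = fun c => 2 * L1 .h s2 s3 c + piG * L1 .e s2 s3 c + piC * L1 .ebar s2 s3 c := funext (L2_expand s2 s3)
  unfold Φ2 Φ1; rw [e, Tf_lin3]
theorem Φ3_expand (D : Design) (s3 : Sym) : Φ3 D s3 = 2 * Φ2 D .h s3 + piG * Φ2 D .e s3 + piC * Φ2 D .ebar s3 := by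
  have e : L3 s3 = fun c => 2 * L2 .h s3 c + piG * L2 .e s3 c + piC * L2 .ebar s3 c := funext (L3_expand s3)
  unfold Φ3 Φ2; rw [e, Tf_lin3]
theorem Φ4_expand (D : Design) : Φ4 D = 2 * Φ3 D .h + piG * Φ3 D .e + piC * Φ3 D .ebar := by
  have e : L4 = fun c => 2 * L3 .h c + piG * L3 .e c + piC * L3 .ebar c := funext L4_expand
  unfold Φ4 Φ3; rw [e, Tf_lin3]
theorem Φ4d_expand (D : Design) : Φ4d D = 2 * Φ3 D .h + piC * Φ3 D .e + piG * Φ3 D .ebar := by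
  have e : L4d = fun c => 2 * L3 .h c + piC * L3 .e c + piG * L3 .ebar c := funext L4d_expand
  unfold Φ4d Φ3; rw [e, Tf_lin3]

/-! ## §4 Evaluation of the level functionals under (A1).1 (mechanical: each line is one recursion step + the listed zero words) -/

theorem Φ1_ooo (D : Design) (hz : ZT D) : Φ1 D .one .one .one = 2 * D.T (W .h .one .one .one) := by
  have ex := Φ1_expand D .one .one .one
  rw [T0 D hz .e .one .one .one (by decide), T0 D hz .ebar .one .one .one (by decide)] at ex
  linear_combination ex

theorem Φ1_ppp (D : Design) (hz : ZT D) : Φ1 D .pt .pt .pt = 2 * D.T (W .h .pt .pt .pt) := by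
  have ex := Φ1_expand D .pt .pt .pt
  rw [T0 D hz .e .pt .pt .pt (by decide), T0 D hz .ebar .pt .pt .pt (by decide)] at ex
  linear_combination ex

theorem Φ1_hoo (D : Design) (hz : ZT D) : Φ1 D .h .one .one = 2 * D.T (W .h .h .one .one) := by
  have ex := Φ1_expand D .h .one .one
  rw [T0 D hz .e .h .one .one (by decide), T0 D hz .ebar .h .one .one (by decide)] at ex
  linear_combination ex

theorem Φ1_eoo (D : Design) (hz : ZT D) : Φ1 D .e .one .one = 0 := by
  have ex := Φ1_expand D .e .one .one
  rw [T0 D hz .h .e .one .one (by decide), T0 D hz .e .e .one .one (by decide), T0 D hz .ebar .e .one .one (by decide)] at ex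
  linear_combination ex

theorem Φ1_Eoo (D : Design) (hz : ZT D) : Φ1 D .ebar .one .one = 0 := by
  have ex := Φ1_expand D .ebar .one .one
  rw [T0 D hz .h .ebar .one .one (by decide), T0 D hz .e .ebar .one .one (by decide), T0 D hz .ebar .ebar .one .one (by decide)] at ex
  linear_combination ex

theorem Φ1_hpo (D : Design) (hz : ZT D) : Φ1 D .h .pt .one = 2 * D.T (W .h .h .pt .one) := by
  have ex := Φ1_expand D .h .pt .one
  rw [T0 D hz .e .h .pt .one (by decide), T0 D hz .ebar .h .pt .one (by decide)] at ex
  linear_combination ex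

theorem Φ1_epo (D : Design) (hz : ZT D) : Φ1 D .e .pt .one = 0 := by
  have ex := Φ1_expand D .e .pt .one
  rw [T0 D hz .h .e .pt .one (by decide), T0 D hz .e .e .pt .one (by decide), T0 D hz .ebar .e .pt .one (by decide)] at ex
  linear_combination ex

theorem Φ1_Epo (D : Design) (hz : ZT D) : Φ1 D .ebar .pt .one = 0 := by
  have ex := Φ1_expand D .ebar .pt .one
  rw [T0 D hz .h .ebar .pt .one (by decide), T0 D hz .e .ebar .pt .one (by decide), T0 D hz .ebar .ebar .pt .one (by decide)] at ex
  linear_combination ex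

theorem Φ1_hpp (D : Design) (hz : ZT D) : Φ1 D .h .pt .pt = 2 * D.T (W .h .h .pt .pt) := by
  have ex := Φ1_expand D .h .pt .pt
  rw [T0 D hz .e .h .pt .pt (by decide), T0 D hz .ebar .h .pt .pt (by decide)] at ex
  linear_combination ex

theorem Φ1_epp (D : Design) (hz : ZT D) : Φ1 D .e .pt .pt = 0 := by
  have ex := Φ1_expand D .e .pt .pt
  rw [T0 D hz .h .e .pt .pt (by decide), T0 D hz .e .e .pt .pt (by decide), T0 D hz .ebar .e .pt .pt (by decide)] at ex
  linear_combination ex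

theorem Φ1_Epp (D : Design) (hz : ZT D) : Φ1 D .ebar .pt .pt = 0 := by
  have ex := Φ1_expand D .ebar .pt .pt
  rw [T0 D hz .h .ebar .pt .pt (by decide), T0 D hz .e .ebar .pt .pt (by decide), T0 D hz .ebar .ebar .pt .pt (by decide)] at ex
  linear_combination ex

theorem Φ1_hho (D : Design) (hz : ZT D) : Φ1 D .h .h .one = 2 * D.T (W .h .h .h .one) := by
  have ex := Φ1_expand D .h .h .one
  rw [T0 D hz .e .h .h .one (by decide), T0 D hz .ebar .h .h .one (by decide)] at ex
  linear_combination ex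

theorem Φ1_heo (D : Design) (hz : ZT D) : Φ1 D .h .e .one = 0 := by
  have ex := Φ1_expand D .h .e .one
  rw [T0 D hz .h .h .e .one (by decide), T0 D hz .e .h .e .one (by decide), T0 D hz .ebar .h .e .one (by decide)] at ex
  linear_combination ex

theorem Φ1_hEo (D : Design) (hz : ZT D) : Φ1 D .h .ebar .one = 0 := by
  have ex := Φ1_expand D .h .ebar .one
  rw [T0 D hz .h .h .ebar .one (by decide), T0 D hz .e .h .ebar .one (by decide), T0 D hz .ebar .h .ebar .one (by decide)] at ex
  linear_combination ex

theorem Φ1_eho (D : Design) (hz : ZT D) : Φ1 D .e .h .one = 0 := by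
  have ex := Φ1_expand D .e .h .one
  rw [T0 D hz .h .e .h .one (by decide), T0 D hz .e .e .h .one (by decide), T0 D hz .ebar .e .h .one (by decide)] at ex
  linear_combination ex

theorem Φ1_eeo (D : Design) (hz : ZT D) : Φ1 D .e .e .one = 0 := by
  have ex := Φ1_expand D .e .e .one
  rw [T0 D hz .h .e .e .one (by decide), T0 D hz .e .e .e .one (by decide), T0 D hz .ebar .e .e .one (by decide)] at ex
  linear_combination ex

theorem Φ1_eEo (D : Design) (hz : ZT D) : Φ1 D .e .ebar .one = 0 := by
  have ex := Φ1_expand D .e .ebar .one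
  rw [T0 D hz .h .e .ebar .one (by decide), T0 D hz .e .e .ebar .one (by decide), T0 D hz .ebar .e .ebar .one (by decide)] at ex
  linear_combination ex

theorem Φ1_Eho (D : Design) (hz : ZT D) : Φ1 D .ebar .h .one = 0 := by
  have ex := Φ1_expand D .ebar .h .one
  rw [T0 D hz .h .ebar .h .one (by decide), T0 D hz .e .ebar .h .one (by decide), T0 D hz .ebar .ebar .h .one (by decide)] at ex
  linear_combination ex

theorem Φ1_Eeo (D : Design) (hz : ZT D) : Φ1 D .ebar .e .one = 0 := by
  have ex := Φ1_expand D .ebar .e .one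
  rw [T0 D hz .h .ebar .e .one (by decide), T0 D hz .e .ebar .e .one (by decide), T0 D hz .ebar .ebar .e .one (by decide)] at ex
  linear_combination ex

theorem Φ1_EEo (D : Design) (hz : ZT D) : Φ1 D .ebar .ebar .one = 0 := by
  have ex := Φ1_expand D .ebar .ebar .one
  rw [T0 D hz .h .ebar .ebar .one (by decide), T0 D hz .e .ebar .ebar .one (by decide), T0 D hz .ebar .ebar .ebar .one (by decide)] at ex
  linear_combination ex

theorem Φ1_hhp (D : Design) (hz : ZT D) : Φ1 D .h .h .pt = 2 * D.T (W .h .h .h .pt) := by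
  have ex := Φ1_expand D .h .h .pt
  rw [T0 D hz .e .h .h .pt (by decide), T0 D hz .ebar .h .h .pt (by decide)] at ex
  linear_combination ex

theorem Φ1_hep (D : Design) (hz : ZT D) : Φ1 D .h .e .pt = 0 := by
  have ex := Φ1_expand D .h .e .pt
  rw [T0 D hz .h .h .e .pt (by decide), T0 D hz .e .h .e .pt (by decide), T0 D hz .ebar .h .e .pt (by decide)] at ex
  linear_combination ex

theorem Φ1_hEp (D : Design) (hz : ZT D) : Φ1 D .h .ebar .pt = 0 := by
  have ex := Φ1_expand D .h .ebar .pt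
  rw [T0 D hz .h .h .ebar .pt (by decide), T0 D hz .e .h .ebar .pt (by decide), T0 D hz .ebar .h .ebar .pt (by decide)] at ex
  linear_combination ex

theorem Φ1_ehp (D : Design) (hz : ZT D) : Φ1 D .e .h .pt = 0 := by
  have ex := Φ1_expand D .e .h .pt
  rw [T0 D hz .h .e .h .pt (by decide), T0 D hz .e .e .h .pt (by decide), T0 D hz .ebar .e .h .pt (by decide)] at ex
  linear_combination ex

theorem Φ1_eep (D : Design) (hz : ZT D) : Φ1 D .e .e .pt = 0 := by
  have ex := Φ1_expand D .e .e .pt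
  rw [T0 D hz .h .e .e .pt (by decide), T0 D hz .e .e .e .pt (by decide), T0 D hz .ebar .e .e .pt (by decide)] at ex
  linear_combination ex

theorem Φ1_eEp (D : Design) (hz : ZT D) : Φ1 D .e .ebar .pt = 0 := by
  have ex := Φ1_expand D .e .ebar .pt
  rw [T0 D hz .h .e .ebar .pt (by decide), T0 D hz .e .e .ebar .pt (by decide), T0 D hz .ebar .e .ebar .pt (by decide)] at ex
  linear_combination ex

theorem Φ1_Ehp (D : Design) (hz : ZT D) : Φ1 D .ebar .h .pt = 0 := by
  have ex := Φ1_expand D .ebar .h .pt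
  rw [T0 D hz .h .ebar .h .pt (by decide), T0 D hz .e .ebar .h .pt (by decide), T0 D hz .ebar .ebar .h .pt (by decide)] at ex
  linear_combination ex

theorem Φ1_Eep (D : Design) (hz : ZT D) : Φ1 D .ebar .e .pt = 0 := by
  have ex := Φ1_expand D .ebar .e .pt
  rw [T0 D hz .h .ebar .e .pt (by decide), T0 D hz .e .ebar .e .pt (by decide), T0 D hz .ebar .ebar .e .pt (by decide)] at ex
  linear_combination ex

theorem Φ1_EEp (D : Design) (hz : ZT D) : Φ1 D .ebar .ebar .pt = 0 := by
  have ex := Φ1_expand D .ebar .ebar .pt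
  rw [T0 D hz .h .ebar .ebar .pt (by decide), T0 D hz .e .ebar .ebar .pt (by decide), T0 D hz .ebar .ebar .ebar .pt (by decide)] at ex
  linear_combination ex

theorem Φ1_hhh (D : Design) (hz : ZT D) : Φ1 D .h .h .h = 2 * D.T (W .h .h .h .h) := by
  have ex := Φ1_expand D .h .h .h
  rw [T0 D hz .e .h .h .h (by decide), T0 D hz .ebar .h .h .h (by decide)] at ex
  linear_combination ex

theorem Φ1_hhe (D : Design) (hz : ZT D) : Φ1 D .h .h .e = 0 := by
  have ex := Φ1_expand D .h .h .e
  rw [T0 D hz .h .h .h .e (by decide), T0 D hz .e .h .h .e (by decide), T0 D hz .ebar .h .h .e (by decide)] at ex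
  linear_combination ex

theorem Φ1_hhE (D : Design) (hz : ZT D) : Φ1 D .h .h .ebar = 0 := by
  have ex := Φ1_expand D .h .h .ebar
  rw [T0 D hz .h .h .h .ebar (by decide), T0 D hz .e .h .h .ebar (by decide), T0 D hz .ebar .h .h .ebar (by decide)] at ex
  linear_combination ex

theorem Φ1_heh (D : Design) (hz : ZT D) : Φ1 D .h .e .h = 0 := by
  have ex := Φ1_expand D .h .e .h
  rw [T0 D hz .h .h .e .h (by decide), T0 D hz .e .h .e .h (by decide), T0 D hz .ebar .h .e .h (by decide)] at ex
  linear_combination ex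

theorem Φ1_hee (D : Design) (hz : ZT D) : Φ1 D .h .e .e = 0 := by
  have ex := Φ1_expand D .h .e .e
  rw [T0 D hz .h .h .e .e (by decide), T0 D hz .e .h .e .e (by decide), T0 D hz .ebar .h .e .e (by decide)] at ex
  linear_combination ex

theorem Φ1_heE (D : Design) (hz : ZT D) : Φ1 D .h .e .ebar = 0 := by
  have ex := Φ1_expand D .h .e .ebar
  rw [T0 D hz .h .h .e .ebar (by decide), T0 D hz .e .h .e .ebar (by decide), T0 D hz .ebar .h .e .ebar (by decide)] at ex
  linear_combination ex

theorem Φ1_hEh (D : Design) (hz : ZT D) : Φ1 D .h .ebar .h = 0 := by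
  have ex := Φ1_expand D .h .ebar .h
  rw [T0 D hz .h .h .ebar .h (by decide), T0 D hz .e .h .ebar .h (by decide), T0 D hz .ebar .h .ebar .h (by decide)] at ex
  linear_combination ex

theorem Φ1_hEe (D : Design) (hz : ZT D) : Φ1 D .h .ebar .e = 0 := by
  have ex := Φ1_expand D .h .ebar .e
  rw [T0 D hz .h .h .ebar .e (by decide), T0 D hz .e .h .ebar .e (by decide), T0 D hz .ebar .h .ebar .e (by decide)] at ex
  linear_combination ex

theorem Φ1_hEE (D : Design) (hz : ZT D) : Φ1 D .h .ebar .ebar = 0 := by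
  have ex := Φ1_expand D .h .ebar .ebar
  rw [T0 D hz .h .h .ebar .ebar (by decide), T0 D hz .e .h .ebar .ebar (by decide), T0 D hz .ebar .h .ebar .ebar (by decide)] at ex
  linear_combination ex

theorem Φ1_ehh (D : Design) (hz : ZT D) : Φ1 D .e .h .h = 0 := by
  have ex := Φ1_expand D .e .h .h
  rw [T0 D hz .h .e .h .h (by decide), T0 D hz .e .e .h .h (by decide), T0 D hz .ebar .e .h .h (by decide)] at ex
  linear_combination ex

theorem Φ1_ehe (D : Design) (hz : ZT D) : Φ1 D .e .h .e = 0 := by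
  have ex := Φ1_expand D .e .h .e
  rw [T0 D hz .h .e .h .e (by decide), T0 D hz .e .e .h .e (by decide), T0 D hz .ebar .e .h .e (by decide)] at ex
  linear_combination ex

theorem Φ1_ehE (D : Design) (hz : ZT D) : Φ1 D .e .h .ebar = 0 := by
  have ex := Φ1_expand D .e .h .ebar
  rw [T0 D hz .h .e .h .ebar (by decide), T0 D hz .e .e .h .ebar (by decide), T0 D hz .ebar .e .h .ebar (by decide)] at ex
  linear_combination ex

theorem Φ1_eeh (D : Design) (hz : ZT D) : Φ1 D .e .e .h = 0 := by
  have ex := Φ1_expand D .e .e .h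
  rw [T0 D hz .h .e .e .h (by decide), T0 D hz .e .e .e .h (by decide), T0 D hz .ebar .e .e .h (by decide)] at ex
  linear_combination ex

theorem Φ1_eee (D : Design) (hz : ZT D) : Φ1 D .e .e .e = piG * D.mu := by
  have ex := Φ1_expand D .e .e .e
  rw [T0 D hz .h .e .e .e (by decide), T0 D hz .ebar .e .e .e (by decide), W_eeee] at ex
  rw [T_eeee] at ex
  linear_combination ex

theorem Φ1_eeE (D : Design) (hz : ZT D) : Φ1 D .e .e .ebar = 0 := by
  have ex := Φ1_expand D .e .e .ebar
  rw [T0 D hz .h .e .e .ebar (by decide), T0 D hz .e .e .e .ebar (by decide), T0 D hz .ebar .e .e .ebar (by decide)] at ex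
  linear_combination ex

theorem Φ1_eEh (D : Design) (hz : ZT D) : Φ1 D .e .ebar .h = 0 := by
  have ex := Φ1_expand D .e .ebar .h
  rw [T0 D hz .h .e .ebar .h (by decide), T0 D hz .e .e .ebar .h (by decide), T0 D hz .ebar .e .ebar .h (by decide)] at ex
  linear_combination ex

theorem Φ1_eEe (D : Design) (hz : ZT D) : Φ1 D .e .ebar .e = 0 := by
  have ex := Φ1_expand D .e .ebar .e
  rw [T0 D hz .h .e .ebar .e (by decide), T0 D hz .e .e .ebar .e (by decide), T0 D hz .ebar .e .ebar .e (by decide)] at ex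
  linear_combination ex

theorem Φ1_eEE (D : Design) (hz : ZT D) : Φ1 D .e .ebar .ebar = 0 := by
  have ex := Φ1_expand D .e .ebar .ebar
  rw [T0 D hz .h .e .ebar .ebar (by decide), T0 D hz .e .e .ebar .ebar (by decide), T0 D hz .ebar .e .ebar .ebar (by decide)] at ex
  linear_combination ex

theorem Φ1_Ehh (D : Design) (hz : ZT D) : Φ1 D .ebar .h .h = 0 := by
  have ex := Φ1_expand D .ebar .h .h
  rw [T0 D hz .h .ebar .h .h (by decide), T0 D hz .e .ebar .h .h (by decide), T0 D hz .ebar .ebar .h .h (by decide)] at ex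
  linear_combination ex

theorem Φ1_Ehe (D : Design) (hz : ZT D) : Φ1 D .ebar .h .e = 0 := by
  have ex := Φ1_expand D .ebar .h .e
  rw [T0 D hz .h .ebar .h .e (by decide), T0 D hz .e .ebar .h .e (by decide), T0 D hz .ebar .ebar .h .e (by decide)] at ex
  linear_combination ex

theorem Φ1_EhE (D : Design) (hz : ZT D) : Φ1 D .ebar .h .ebar = 0 := by
  have ex := Φ1_expand D .ebar .h .ebar
  rw [T0 D hz .h .ebar .h .ebar (by decide), T0 D hz .e .ebar .h .ebar (by decide), T0 D hz .ebar .ebar .h .ebar (by decide)] at ex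
  linear_combination ex

theorem Φ1_Eeh (D : Design) (hz : ZT D) : Φ1 D .ebar .e .h = 0 := by
  have ex := Φ1_expand D .ebar .e .h
  rw [T0 D hz .h .ebar .e .h (by decide), T0 D hz .e .ebar .e .h (by decide), T0 D hz .ebar .ebar .e .h (by decide)] at ex
  linear_combination ex

theorem Φ1_Eee (D : Design) (hz : ZT D) : Φ1 D .ebar .e .e = 0 := by
  have ex := Φ1_expand D .ebar .e .e
  rw [T0 D hz .h .ebar .e .e (by decide), T0 D hz .e .ebar .e .e (by decide), T0 D hz .ebar .ebar .e .e (by decide)] at ex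
  linear_combination ex

theorem Φ1_EeE (D : Design) (hz : ZT D) : Φ1 D .ebar .e .ebar = 0 := by
  have ex := Φ1_expand D .ebar .e .ebar
  rw [T0 D hz .h .ebar .e .ebar (by decide), T0 D hz .e .ebar .e .ebar (by decide), T0 D hz .ebar .ebar .e .ebar (by decide)] at ex
  linear_combination ex

theorem Φ1_EEh (D : Design) (hz : ZT D) : Φ1 D .ebar .ebar .h = 0 := by
  have ex := Φ1_expand D .ebar .ebar .h
  rw [T0 D hz .h .ebar .ebar .h (by decide), T0 D hz .e .ebar .ebar .h (by decide), T0 D hz .ebar .ebar .ebar .h (by decide)] at ex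
  linear_combination ex

theorem Φ1_EEe (D : Design) (hz : ZT D) : Φ1 D .ebar .ebar .e = 0 := by
  have ex := Φ1_expand D .ebar .ebar .e
  rw [T0 D hz .h .ebar .ebar .e (by decide), T0 D hz .e .ebar .ebar .e (by decide), T0 D hz .ebar .ebar .ebar .e (by decide)] at ex
  linear_combination ex

theorem Φ1_EEE (D : Design) (hz : ZT D) : Φ1 D .ebar .ebar .ebar = piC * D.T Word.EEEE := by
  have ex := Φ1_expand D .ebar .ebar .ebar
  rw [T0 D hz .h .ebar .ebar .ebar (by decide), T0 D hz .e .ebar .ebar .ebar (by decide), W_EEEE] at ex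
  linear_combination ex

theorem Φ2_oo (D : Design) (hz : ZT D) : Φ2 D .one .one = 2 * (2 * D.T (W .h .h .one .one)) := by
  have ex := Φ2_expand D .one .one
  rw [Φ1_hoo D hz, Φ1_eoo D hz, Φ1_Eoo D hz] at ex
  linear_combination ex

theorem Φ2_po (D : Design) (hz : ZT D) : Φ2 D .pt .one = 2 * (2 * D.T (W .h .h .pt .one)) := by
  have ex := Φ2_expand D .pt .one
  rw [Φ1_hpo D hz, Φ1_epo D hz, Φ1_Epo D hz] at ex
  linear_combination ex

theorem Φ2_pp (D : Design) (hz : ZT D) : Φ2 D .pt .pt = 2 * (2 * D.T (W .h .h .pt .pt)) := by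
  have ex := Φ2_expand D .pt .pt
  rw [Φ1_hpp D hz, Φ1_epp D hz, Φ1_Epp D hz] at ex
  linear_combination ex

theorem Φ2_ho (D : Design) (hz : ZT D) : Φ2 D .h .one = 2 * (2 * D.T (W .h .h .h .one)) := by
  have ex := Φ2_expand D .h .one
  rw [Φ1_hho D hz, Φ1_eho D hz, Φ1_Eho D hz] at ex
  linear_combination ex

theorem Φ2_eo (D : Design) (hz : ZT D) : Φ2 D .e .one = 0 := by
  have ex := Φ2_expand D .e .one
  rw [Φ1_heo D hz, Φ1_eeo D hz, Φ1_Eeo D hz] at ex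
  linear_combination ex

theorem Φ2_Eo (D : Design) (hz : ZT D) : Φ2 D .ebar .one = 0 := by
  have ex := Φ2_expand D .ebar .one
  rw [Φ1_hEo D hz, Φ1_eEo D hz, Φ1_EEo D hz] at ex
  linear_combination ex

theorem Φ2_hp (D : Design) (hz : ZT D) : Φ2 D .h .pt = 2 * (2 * D.T (W .h .h .h .pt)) := by
  have ex := Φ2_expand D .h .pt
  rw [Φ1_hhp D hz, Φ1_ehp D hz, Φ1_Ehp D hz] at ex
  linear_combination ex

theorem Φ2_ep (D : Design) (hz : ZT D) : Φ2 D .e .pt = 0 := by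
  have ex := Φ2_expand D .e .pt
  rw [Φ1_hep D hz, Φ1_eep D hz, Φ1_Eep D hz] at ex
  linear_combination ex

theorem Φ2_Ep (D : Design) (hz : ZT D) : Φ2 D .ebar .pt = 0 := by
  have ex := Φ2_expand D .ebar .pt
  rw [Φ1_hEp D hz, Φ1_eEp D hz, Φ1_EEp D hz] at ex
  linear_combination ex

theorem Φ2_hh (D : Design) (hz : ZT D) : Φ2 D .h .h = 2 * (2 * D.T (W .h .h .h .h)) := by
  have ex := Φ2_expand D .h .h
  rw [Φ1_hhh D hz, Φ1_ehh D hz, Φ1_Ehh D hz] at ex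
  linear_combination ex

theorem Φ2_he (D : Design) (hz : ZT D) : Φ2 D .h .e = 0 := by
  have ex := Φ2_expand D .h .e
  rw [Φ1_hhe D hz, Φ1_ehe D hz, Φ1_Ehe D hz] at ex
  linear_combination ex

theorem Φ2_hE (D : Design) (hz : ZT D) : Φ2 D .h .ebar = 0 := by
  have ex := Φ2_expand D .h .ebar
  rw [Φ1_hhE D hz, Φ1_ehE D hz, Φ1_EhE D hz] at ex
  linear_combination ex

theorem Φ2_eh (D : Design) (hz : ZT D) : Φ2 D .e .h = 0 := by
  have ex := Φ2_expand D .e .h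
  rw [Φ1_heh D hz, Φ1_eeh D hz, Φ1_Eeh D hz] at ex
  linear_combination ex

theorem Φ2_ee (D : Design) (hz : ZT D) : Φ2 D .e .e = piG * (piG * D.mu) := by
  have ex := Φ2_expand D .e .e
  rw [Φ1_hee D hz, Φ1_eee D hz, Φ1_Eee D hz] at ex
  linear_combination ex

theorem Φ2_eE (D : Design) (hz : ZT D) : Φ2 D .e .ebar = 0 := by
  have ex := Φ2_expand D .e .ebar
  rw [Φ1_heE D hz, Φ1_eeE D hz, Φ1_EeE D hz] at ex
  linear_combination ex

theorem Φ2_Eh (D : Design) (hz : ZT D) : Φ2 D .ebar .h = 0 := by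
  have ex := Φ2_expand D .ebar .h
  rw [Φ1_hEh D hz, Φ1_eEh D hz, Φ1_EEh D hz] at ex
  linear_combination ex

theorem Φ2_Ee (D : Design) (hz : ZT D) : Φ2 D .ebar .e = 0 := by
  have ex := Φ2_expand D .ebar .e
  rw [Φ1_hEe D hz, Φ1_eEe D hz, Φ1_EEe D hz] at ex
  linear_combination ex

theorem Φ2_EE (D : Design) (hz : ZT D) : Φ2 D .ebar .ebar = piC * (piC * D.T Word.EEEE) := by
  have ex := Φ2_expand D .ebar .ebar
  rw [Φ1_hEE D hz, Φ1_eEE D hz, Φ1_EEE D hz] at ex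
  linear_combination ex

theorem Φ3_o (D : Design) (hz : ZT D) : Φ3 D .one = 2 * (2 * (2 * D.T (W .h .h .h .one))) := by
  have ex := Φ3_expand D .one
  rw [Φ2_ho D hz, Φ2_eo D hz, Φ2_Eo D hz] at ex
  linear_combination ex

theorem Φ3_p (D : Design) (hz : ZT D) : Φ3 D .pt = 2 * (2 * (2 * D.T (W .h .h .h .pt))) := by
  have ex := Φ3_expand D .pt
  rw [Φ2_hp D hz, Φ2_ep D hz, Φ2_Ep D hz] at ex
  linear_combination ex

theorem Φ3_h (D : Design) (hz : ZT D) : Φ3 D .h = 2 * (2 * (2 * D.T (W .h .h .h .h))) := by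
  have ex := Φ3_expand D .h
  rw [Φ2_hh D hz, Φ2_eh D hz, Φ2_Eh D hz] at ex
  linear_combination ex

theorem Φ3_e (D : Design) (hz : ZT D) : Φ3 D .e = piG * (piG * (piG * D.mu)) := by
  have ex := Φ3_expand D .e
  rw [Φ2_he D hz, Φ2_ee D hz, Φ2_Ee D hz] at ex
  linear_combination ex

theorem Φ3_E (D : Design) (hz : ZT D) : Φ3 D .ebar = piC * (piC * (piC * D.T Word.EEEE)) := by
  have ex := Φ3_expand D .ebar
  rw [Φ2_hE D hz, Φ2_eE D hz, Φ2_EE D hz] at ex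
  linear_combination ex

theorem Φ4_val (D : Design) (hz : ZT D) : Φ4 D = 2 * (2 * (2 * (2 * D.T (W .h .h .h .h)))) + piG * (piG * (piG * (piG * D.mu))) + piC * (piC * (piC * (piC * D.T Word.EEEE))) := by
  have ex := Φ4_expand D
  rw [Φ3_h D hz, Φ3_e D hz, Φ3_E D hz] at ex
  linear_combination ex

theorem Φ4d_val (D : Design) (hz : ZT D) : Φ4d D = 2 * (2 * (2 * (2 * D.T (W .h .h .h .h)))) + piC * (piG * (piG * (piG * D.mu))) + piG * (piC * (piC * (piC * D.T Word.EEEE))) := by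
  have ex := Φ4d_expand D
  rw [Φ3_h D hz, Φ3_e D hz, Φ3_E D hz] at ex
  linear_combination ex

/-! ## §5 The level functionals are integer sums divisible by `4^k · 2^j` -/

theorem wsum_intCast (L : List (Cell × ℕ)) (φ : Cell → ℤ) :
    wsum L (fun c => ((φ c : ℤ) : GaussianInt)) = ((linZ L φ : ℤ) : GaussianInt) := by
  rw [linZ_cast]; rfl

theorem Tf_intCast (D : Design) (φ : Cell → ℤ) : Tf D (fun c => ((φ c : ℤ) : GaussianInt)) = ((Lz D φ : ℤ) : GaussianInt) := by
  unfold Tf Lz; rw [wsum_intCast, wsum_intCast, Int.cast_sub]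

/-- the integer cell functions behind `Φ₁(111), Φ₁(ppp), Φ₂(11), Φ₂(p1), Φ₂(pp), Φ₃(1), Φ₃(p), Φ₄, Φ₄'`. -/
def ψ1 (c : Cell) : ℤ := 2 * hs (c 0)
/-- `2(a₀+x₀+y₀)·n₁n₂n₃`. -/
def ψ7 (c : Cell) : ℤ := 2 * hs (c 0) * ((c 1).selfInt * (c 2).selfInt * (c 3).selfInt)
/-- `2hs₀·2hs₁`. -/
def ψ2 (c : Cell) : ℤ := 2 * hs (c 0) * (2 * hs (c 1))
/-- `2hs₀·2hs₁·n₂`. -/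
def ψ4 (c : Cell) : ℤ := 2 * hs (c 0) * (2 * hs (c 1)) * (c 2).selfInt
/-- `2hs₀·2hs₁·n₂n₃`. -/
def ψ6 (c : Cell) : ℤ := 2 * hs (c 0) * (2 * hs (c 1)) * ((c 2).selfInt * (c 3).selfInt)
/-- `2hs₀·2hs₁·2hs₂`. -/
def ψ3 (c : Cell) : ℤ := 2 * hs (c 0) * (2 * hs (c 1)) * (2 * hs (c 2))
/-- `2hs₀·2hs₁·2hs₂·n₃`. -/
def ψ5 (c : Cell) : ℤ := 2 * hs (c 0) * (2 * hs (c 1)) * (2 * hs (c 2)) * (c 3).selfInt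
/-- `2hs₀·2hs₁·2hs₂·2hs₃`. -/
def ψ8 (c : Cell) : ℤ := 2 * hs (c 0) * (2 * hs (c 1)) * (2 * hs (c 2)) * (2 * hs (c 3))
/-- `2hs₀·2hs₁·2hs₂·2hd₃`. -/
def ψ8d (c : Cell) : ℤ := 2 * hs (c 0) * (2 * hs (c 1)) * (2 * hs (c 2)) * (2 * hd (c 3))

theorem L1_ooo_eq (c : Cell) : L1 .one .one .one c = ((ψ1 c : ℤ) : GaussianInt) := by
  unfold L1 ψ1; rw [sg_eq]; simp [Sym.coef]
theorem L1_ppp_eq (c : Cell) : L1 .pt .pt .pt c = ((ψ7 c : ℤ) : GaussianInt) := by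
  unfold L1 ψ7; rw [sg_eq]; simp [Sym.coef]
theorem L2_oo_eq (c : Cell) : L2 .one .one c = ((ψ2 c : ℤ) : GaussianInt) := by
  unfold L2 ψ2; rw [sg_eq, sg_eq]; simp [Sym.coef]
theorem L2_po_eq (c : Cell) : L2 .pt .one c = ((ψ4 c : ℤ) : GaussianInt) := by
  unfold L2 ψ4; rw [sg_eq, sg_eq]; simp [Sym.coef]
theorem L2_pp_eq (c : Cell) : L2 .pt .pt c = ((ψ6 c : ℤ) : GaussianInt) := by
  unfold L2 ψ6; rw [sg_eq, sg_eq]; simp [Sym.coef]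
theorem L3_o_eq (c : Cell) : L3 .one c = ((ψ3 c : ℤ) : GaussianInt) := by
  unfold L3 ψ3; rw [sg_eq, sg_eq, sg_eq]; simp [Sym.coef]
theorem L3_p_eq (c : Cell) : L3 .pt c = ((ψ5 c : ℤ) : GaussianInt) := by
  unfold L3 ψ5; rw [sg_eq, sg_eq, sg_eq]; simp [Sym.coef]
theorem L4_eq (c : Cell) : L4 c = ((ψ8 c : ℤ) : GaussianInt) := by
  unfold L4 ψ8; rw [sg_eq, sg_eq, sg_eq, sg_eq]; push_cast; ring
theorem L4d_eq (c : Cell) : L4d c = ((ψ8d c : ℤ) : GaussianInt) := by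
  unfold L4d ψ8d; rw [sg_eq, sg_eq, sg_eq, sd_eq]; push_cast; ring

theorem Φ1_ooo_cast (D : Design) : Φ1 D .one .one .one = ((Lz D ψ1 : ℤ) : GaussianInt) := by
  unfold Φ1; rw [show L1 .one .one .one = fun c => ((ψ1 c : ℤ) : GaussianInt) from funext L1_ooo_eq, Tf_intCast]
theorem Φ1_ppp_cast (D : Design) : Φ1 D .pt .pt .pt = ((Lz D ψ7 : ℤ) : GaussianInt) := by
  unfold Φ1; rw [show L1 .pt .pt .pt = fun c => ((ψ7 c : ℤ) : GaussianInt) from funext L1_ppp_eq, Tf_intCast]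
theorem Φ2_oo_cast (D : Design) : Φ2 D .one .one = ((Lz D ψ2 : ℤ) : GaussianInt) := by
  unfold Φ2; rw [show L2 .one .one = fun c => ((ψ2 c : ℤ) : GaussianInt) from funext L2_oo_eq, Tf_intCast]
theorem Φ2_po_cast (D : Design) : Φ2 D .pt .one = ((Lz D ψ4 : ℤ) : GaussianInt) := by
  unfold Φ2; rw [show L2 .pt .one = fun c => ((ψ4 c : ℤ) : GaussianInt) from funext L2_po_eq, Tf_intCast]
theorem Φ2_pp_cast (D : Design) : Φ2 D .pt .pt = ((Lz D ψ6 : ℤ) : GaussianInt) := by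
  unfold Φ2; rw [show L2 .pt .pt = fun c => ((ψ6 c : ℤ) : GaussianInt) from funext L2_pp_eq, Tf_intCast]
theorem Φ3_o_cast (D : Design) : Φ3 D .one = ((Lz D ψ3 : ℤ) : GaussianInt) := by
  unfold Φ3; rw [show L3 .one = fun c => ((ψ3 c : ℤ) : GaussianInt) from funext L3_o_eq, Tf_intCast]
theorem Φ3_p_cast (D : Design) : Φ3 D .pt = ((Lz D ψ5 : ℤ) : GaussianInt) := by
  unfold Φ3; rw [show L3 .pt = fun c => ((ψ5 c : ℤ) : GaussianInt) from funext L3_p_eq, Tf_intCast]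
theorem Φ4_cast (D : Design) : Φ4 D = ((Lz D ψ8 : ℤ) : GaussianInt) := by
  unfold Φ4; rw [show L4 = fun c => ((ψ8 c : ℤ) : GaussianInt) from funext L4_eq, Tf_intCast]
theorem Φ4d_cast (D : Design) : Φ4d D = ((Lz D ψ8d : ℤ) : GaussianInt) := by
  unfold Φ4d; rw [show L4d = fun c => ((ψ8d c : ℤ) : GaussianInt) from funext L4d_eq, Tf_intCast]

/-- cellwise divisibilities on alphabet cells at even height. -/
theorem dvd_ψ1 (h : ℤ) (hh : (2 : ℤ) ∣ h) (c : Cell) (hc : ∀ f : Fin 4, (c f).OnAlphabet h) : (4 : ℤ) ∣ ψ1 c :=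
  four_dvd_two_hs h hh _ (hc 0)
theorem dvd_ψ7 (h : ℤ) (hh : (2 : ℤ) ∣ h) (c : Cell) (hc : ∀ f : Fin 4, (c f).OnAlphabet h) : (32 : ℤ) ∣ ψ7 c := by
  have e : (32 : ℤ) = 4 * (2 * 2 * 2) := by norm_num
  rw [e]; unfold ψ7
  exact mul_dvd_mul (four_dvd_two_hs h hh _ (hc 0)) (mul_dvd_mul (mul_dvd_mul (two_dvd_selfInt h hh _ (hc 1))
    (two_dvd_selfInt h hh _ (hc 2))) (two_dvd_selfInt h hh _ (hc 3)))
theorem dvd_ψ2 (h : ℤ) (hh : (2 : ℤ) ∣ h) (c : Cell) (hc : ∀ f : Fin 4, (c f).OnAlphabet h) : (16 : ℤ) ∣ ψ2 c := by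
  have e : (16 : ℤ) = 4 * 4 := by norm_num
  rw [e]; unfold ψ2
  exact mul_dvd_mul (four_dvd_two_hs h hh _ (hc 0)) (four_dvd_two_hs h hh _ (hc 1))
theorem dvd_ψ4 (h : ℤ) (hh : (2 : ℤ) ∣ h) (c : Cell) (hc : ∀ f : Fin 4, (c f).OnAlphabet h) : (32 : ℤ) ∣ ψ4 c := by
  have e : (32 : ℤ) = 4 * 4 * 2 := by norm_num
  rw [e]; unfold ψ4
  exact mul_dvd_mul (mul_dvd_mul (four_dvd_two_hs h hh _ (hc 0)) (four_dvd_two_hs h hh _ (hc 1))) (two_dvd_selfInt h hh _ (hc 2))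
theorem dvd_ψ6 (h : ℤ) (hh : (2 : ℤ) ∣ h) (c : Cell) (hc : ∀ f : Fin 4, (c f).OnAlphabet h) : (64 : ℤ) ∣ ψ6 c := by
  have e : (64 : ℤ) = 4 * 4 * (2 * 2) := by norm_num
  rw [e]; unfold ψ6
  exact mul_dvd_mul (mul_dvd_mul (four_dvd_two_hs h hh _ (hc 0)) (four_dvd_two_hs h hh _ (hc 1)))
    (mul_dvd_mul (two_dvd_selfInt h hh _ (hc 2)) (two_dvd_selfInt h hh _ (hc 3)))
theorem dvd_ψ3 (h : ℤ) (hh : (2 : ℤ) ∣ h) (c : Cell) (hc : ∀ f : Fin 4, (c f).OnAlphabet h) : (64 : ℤ) ∣ ψ3 c := by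
  have e : (64 : ℤ) = 4 * 4 * 4 := by norm_num
  rw [e]; unfold ψ3
  exact mul_dvd_mul (mul_dvd_mul (four_dvd_two_hs h hh _ (hc 0)) (four_dvd_two_hs h hh _ (hc 1))) (four_dvd_two_hs h hh _ (hc 2))
theorem dvd_ψ5 (h : ℤ) (hh : (2 : ℤ) ∣ h) (c : Cell) (hc : ∀ f : Fin 4, (c f).OnAlphabet h) : (128 : ℤ) ∣ ψ5 c := by
  have e : (128 : ℤ) = 4 * 4 * 4 * 2 := by norm_num
  rw [e]; unfold ψ5
  exact mul_dvd_mul (mul_dvd_mul (mul_dvd_mul (four_dvd_two_hs h hh _ (hc 0)) (four_dvd_two_hs h hh _ (hc 1)))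
    (four_dvd_two_hs h hh _ (hc 2))) (two_dvd_selfInt h hh _ (hc 3))
theorem dvd_ψ8 (h : ℤ) (hh : (2 : ℤ) ∣ h) (c : Cell) (hc : ∀ f : Fin 4, (c f).OnAlphabet h) : (256 : ℤ) ∣ ψ8 c := by
  have e : (256 : ℤ) = 4 * 4 * 4 * 4 := by norm_num
  rw [e]; unfold ψ8
  exact mul_dvd_mul (mul_dvd_mul (mul_dvd_mul (four_dvd_two_hs h hh _ (hc 0)) (four_dvd_two_hs h hh _ (hc 1)))
    (four_dvd_two_hs h hh _ (hc 2))) (four_dvd_two_hs h hh _ (hc 3))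
theorem dvd_ψ8d (h : ℤ) (hh : (2 : ℤ) ∣ h) (c : Cell) (hc : ∀ f : Fin 4, (c f).OnAlphabet h) : (256 : ℤ) ∣ ψ8d c := by
  have e : (256 : ℤ) = 4 * 4 * 4 * 4 := by norm_num
  rw [e]; unfold ψ8d
  exact mul_dvd_mul (mul_dvd_mul (mul_dvd_mul (four_dvd_two_hs h hh _ (hc 0)) (four_dvd_two_hs h hh _ (hc 1)))
    (four_dvd_two_hs h hh _ (hc 2))) (four_dvd_two_hd h hh _ (hc 3))

/-! ## §6 `T(ēēēē) = conj μ`, realness of `T(hhhh)` -/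

theorem cellCoef_eeee_star (c : Cell) : cellCoef c Word.eeee = star (cellCoef c Word.EEEE) := by
  unfold cellCoef Word.eeee Word.EEEE
  simp [Fin.prod_univ_four, Sym.coef, star_mul']

theorem mu_re_eq (D : Design) : D.mu.re = (D.T Word.EEEE).re := by
  unfold Design.mu; rw [T_re, T_re]
  congr 1; funext c; rw [cellCoef_eeee_star, Zsqrtd.re_star]

theorem mu_im_eq (D : Design) : D.mu.im = - (D.T Word.EEEE).im := by
  unfold Design.mu; rw [T_im, T_im]
  have e : (fun c => (cellCoef c Word.eeee).im) = fun c => (-1) * (cellCoef c Word.EEEE).im := by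
    funext c; rw [cellCoef_eeee_star, Zsqrtd.im_star]; ring
  rw [e, Lz_mul]; ring

theorem T_hhhh_im (D : Design) : (D.T (W .h .h .h .h)).im = 0 := T_wH_im D

/-! ## §7 THE CHARGE LATTICE -/

theorem W_hooo_efree : (W .h .one .one .one).efree := by intro f; fin_cases f <;> rfl
theorem W_hhoo_efree : (W .h .h .one .one).efree := by intro f; fin_cases f <;> rfl
theorem W_hhho_efree : (W .h .h .h .one).efree := by intro f; fin_cases f <;> rfl
theorem W_hhpo_efree : (W .h .h .pt .one).efree := by intro f; fin_cases f <;> rfl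
theorem W_hhhp_efree : (W .h .h .h .pt).efree := by intro f; fin_cases f <;> rfl
theorem W_hhpp_efree : (W .h .h .pt .pt).efree := by intro f; fin_cases f <;> rfl
theorem W_hppp_efree : (W .h .pt .pt .pt).efree := by intro f; fin_cases f <;> rfl
theorem W_hhhh_efree : (W .h .h .h .h).efree := by intro f; fin_cases f <;> rfl

/-- The generic closing step: `Φ = 2^k · T(w)` as a cast identity plus `2^k·d ∣ Lz ψ` gives `d ∣ Tz w`. -/
theorem close_dvd (D : Design) (w : Word) (hw : w.efree) (ψ : Cell → ℤ) (k d : ℤ) (hk : k ≠ 0)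
    (hΦ : ((Lz D ψ : ℤ) : GaussianInt) = (k : GaussianInt) * D.T w) (hd : k * d ∣ Lz D ψ) : d ∣ D.Tz w := by
  rw [T_eq_cast_Tz D w hw] at hΦ
  have hre := congrArg Zsqrtd.re hΦ
  simp only [Zsqrtd.re_intCast, Zsqrtd.re_mul, Zsqrtd.im_intCast, mul_zero, add_zero] at hre
  rw [hre] at hd
  exact (mul_dvd_mul_iff_left hk).mp hd

/-- degree 1: `q₁ ∈ 2ℤ`. -/
theorem q1_law (h : ℤ) (hh : (2 : ℤ) ∣ h) (D : Design) (hA : D.OnAlphabet h) (h1 : D.A1) : (2 : ℤ) ∣ D.Tz (W .h .one .one .one) := by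
  have hv := Φ1_ooo D (zt_of_A1 D h1)
  rw [Φ1_ooo_cast] at hv
  refine close_dvd D _ W_hooo_efree ψ1 2 2 (by norm_num) (by rw [hv]; push_cast; ring) ?_
  have := dvd_Lz h D hA ψ1 4 (dvd_ψ1 h hh); norm_num at this ⊢; exact this
/-- degree 2: `q₂ ∈ 4ℤ`. -/
theorem q2_law (h : ℤ) (hh : (2 : ℤ) ∣ h) (D : Design) (hA : D.OnAlphabet h) (h1 : D.A1) : (4 : ℤ) ∣ D.Tz (W .h .h .one .one) := by
  have hv := Φ2_oo D (zt_of_A1 D h1)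
  rw [Φ2_oo_cast] at hv
  refine close_dvd D _ W_hhoo_efree ψ2 4 4 (by norm_num) (by rw [hv]; push_cast; ring) ?_
  have := dvd_Lz h D hA ψ2 16 (dvd_ψ2 h hh); norm_num at this ⊢; exact this
/-- degree 3: `q₃ ∈ 8ℤ`. -/
theorem q3_law (h : ℤ) (hh : (2 : ℤ) ∣ h) (D : Design) (hA : D.OnAlphabet h) (h1 : D.A1) : (8 : ℤ) ∣ D.Tz (W .h .h .h .one) := by
  have hv := Φ3_o D (zt_of_A1 D h1)
  rw [Φ3_o_cast] at hv
  refine close_dvd D _ W_hhho_efree ψ3 8 8 (by norm_num) (by rw [hv]; push_cast; ring) ?_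
  have := dvd_Lz h D hA ψ3 64 (dvd_ψ3 h hh); norm_num at this ⊢; exact this
/-- degree 4: `q₄ ∈ 8ℤ`. -/
theorem q4_law (h : ℤ) (hh : (2 : ℤ) ∣ h) (D : Design) (hA : D.OnAlphabet h) (h1 : D.A1) : (8 : ℤ) ∣ D.Tz (W .h .h .pt .one) := by
  have hv := Φ2_po D (zt_of_A1 D h1)
  rw [Φ2_po_cast] at hv
  refine close_dvd D _ W_hhpo_efree ψ4 4 8 (by norm_num) (by rw [hv]; push_cast; ring) ?_
  have := dvd_Lz h D hA ψ4 32 (dvd_ψ4 h hh); norm_num at this ⊢; exact this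
/-- degree 5: `q₅ ∈ 16ℤ`. -/
theorem q5_law (h : ℤ) (hh : (2 : ℤ) ∣ h) (D : Design) (hA : D.OnAlphabet h) (h1 : D.A1) : (16 : ℤ) ∣ D.Tz (W .h .h .h .pt) := by
  have hv := Φ3_p D (zt_of_A1 D h1)
  rw [Φ3_p_cast] at hv
  refine close_dvd D _ W_hhhp_efree ψ5 8 16 (by norm_num) (by rw [hv]; push_cast; ring) ?_
  have := dvd_Lz h D hA ψ5 128 (dvd_ψ5 h hh); norm_num at this ⊢; exact this
/-- degree 6: `q₆ ∈ 16ℤ`. -/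
theorem q6_law (h : ℤ) (hh : (2 : ℤ) ∣ h) (D : Design) (hA : D.OnAlphabet h) (h1 : D.A1) : (16 : ℤ) ∣ D.Tz (W .h .h .pt .pt) := by
  have hv := Φ2_pp D (zt_of_A1 D h1)
  rw [Φ2_pp_cast] at hv
  refine close_dvd D _ W_hhpp_efree ψ6 4 16 (by norm_num) (by rw [hv]; push_cast; ring) ?_
  have := dvd_Lz h D hA ψ6 64 (dvd_ψ6 h hh); norm_num at this ⊢; exact this
/-- degree 7: `q₇ ∈ 16ℤ`. -/
theorem q7_law (h : ℤ) (hh : (2 : ℤ) ∣ h) (D : Design) (hA : D.OnAlphabet h) (h1 : D.A1) : (16 : ℤ) ∣ D.Tz (W .h .pt .pt .pt) := by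
  have hv := Φ1_ppp D (zt_of_A1 D h1)
  rw [Φ1_ppp_cast] at hv
  refine close_dvd D _ W_hppp_efree ψ7 2 16 (by norm_num) (by rw [hv]; push_cast; ring) ?_
  have := dvd_Lz h D hA ψ7 32 (dvd_ψ7 h hh); norm_num at this ⊢; exact this
/-- degree 8: `q₈ ∈ 16ℤ` (= `SlotLatticeLaw.even_degree_law`, canonical placement `pppp`). -/
theorem q8_law (h : ℤ) (hh : (2 : ℤ) ∣ h) (D : Design) (hA : D.OnAlphabet h) : (16 : ℤ) ∣ D.Tz wPPPP :=
  (even_degree_law h hh D hA).2.2.2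

/-- THE μ-CONGRUENCE: `Re μ ≡ 2·q₄ (mod 32)` and `Im μ ≡ 2·q₄ (mod 32)`. -/
theorem mu_law (h : ℤ) (hh : (2 : ℤ) ∣ h) (D : Design) (hA : D.OnAlphabet h) (h1 : D.A1) :
    (32 : ℤ) ∣ 2 * D.Tz (W .h .h .h .h) - D.mu.re ∧ (32 : ℤ) ∣ 2 * D.Tz (W .h .h .h .h) - D.mu.im := by
  have hz := zt_of_A1 D h1
  have h4 := Φ4_val D hz
  have h4d := Φ4d_val D hz
  rw [Φ4_cast, T_eq_cast_Tz D _ W_hhhh_efree] at h4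
  rw [Φ4d_cast, T_eq_cast_Tz D _ W_hhhh_efree] at h4d
  have r4 := congrArg Zsqrtd.re h4
  have r4d := congrArg Zsqrtd.re h4d
  have hre := mu_re_eq D
  have him := mu_im_eq D
  simp [piG, piC] at r4 r4d
  have d8 : (256 : ℤ) ∣ Lz D ψ8 := dvd_Lz h D hA ψ8 256 (dvd_ψ8 h hh)
  have d8d : (256 : ℤ) ∣ Lz D ψ8d := dvd_Lz h D hA ψ8d 256 (dvd_ψ8d h hh)
  rw [r4] at d8; rw [r4d] at d8d
  constructor
  · have e : (256 : ℤ) = 8 * 32 := by norm_num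
    rw [e] at d8
    have : (8 : ℤ) * 32 ∣ 8 * (2 * D.Tz (W .h .h .h .h) - D.mu.re) := by
      have ee : (8 : ℤ) * (2 * D.Tz (W .h .h .h .h) - D.mu.re) =
        2 * (2 * (2 * (2 * D.Tz (W .h .h .h .h)))) + -(4 * D.mu.re) + -(4 * (D.T Word.EEEE).re) := by rw [← hre]; ring
      rw [ee]; convert d8 using 2 <;> ring
    exact (mul_dvd_mul_iff_left (by norm_num : (8 : ℤ) ≠ 0)).mp this
  · have e : (256 : ℤ) = 8 * 32 := by norm_num
    rw [e] at d8d
    have : (8 : ℤ) * 32 ∣ 8 * (2 * D.Tz (W .h .h .h .h) - D.mu.im) := by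
      have ee : (8 : ℤ) * (2 * D.Tz (W .h .h .h .h) - D.mu.im) =
        2 * (2 * (2 * (2 * D.Tz (W .h .h .h .h)))) + -(4 * D.mu.im) + 4 * (D.T Word.EEEE).im := by rw [him]; ring
      rw [ee]; convert d8d using 2 <;> ring
    exact (mul_dvd_mul_iff_left (by norm_num : (8 : ℤ) ≠ 0)).mp this

/-- THE COMPLETE CHARGE LATTICE at height `h` on the canonical placements of `SlotLatticeLaw` (`q₁ = T(h111), q₂ = T(p111), q₃ = T(ph11), q₄ = T(pp11),
q₅ = T(pph1), q₆ = T(ppp1), q₇ = T(ppph), q₈ = T(pppp)`): the eight optimal contents and the two μ-congruences. -/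
def ChargeLattice (h : ℤ) : Prop := ∀ D : Design, D.OnAlphabet h → D.A1 →
  (2 : ℤ) ∣ D.Tz wH0 ∧ (4 : ℤ) ∣ D.Tz wP ∧ (8 : ℤ) ∣ D.Tz wPH ∧ (8 : ℤ) ∣ D.Tz wPP ∧ (16 : ℤ) ∣ D.Tz wPPH ∧ (16 : ℤ) ∣ D.Tz wPPP ∧
  (16 : ℤ) ∣ D.Tz wPPPH ∧ (16 : ℤ) ∣ D.Tz wPPPP ∧ (32 : ℤ) ∣ 2 * D.Tz wPP - D.mu.re ∧ (32 : ℤ) ∣ 2 * D.Tz wPP - D.mu.im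

theorem chargeLattice_holds (h : ℤ) (hh : (2 : ℤ) ∣ h) : ChargeLattice h := by
  intro D hA h1
  have e1 : D.Tz wH0 = D.Tz (W .h .one .one .one) := Tz_eq_of_A1 D h1 _ _ wH0_efree W_hooo_efree (by decide)
  have e2 : D.Tz wP = D.Tz (W .h .h .one .one) := Tz_eq_of_A1 D h1 _ _ wP_efree W_hhoo_efree (by decide)
  have e3 : D.Tz wPH = D.Tz (W .h .h .h .one) := Tz_eq_of_A1 D h1 _ _ wPH_efree W_hhho_efree (by decide)
  have e4 : D.Tz wPP = D.Tz (W .h .h .pt .one) := Tz_eq_of_A1 D h1 _ _ wPP_efree W_hhpo_efree (by decide)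
  have e4' : D.Tz wPP = D.Tz (W .h .h .h .h) := Tz_eq_of_A1 D h1 _ _ wPP_efree W_hhhh_efree (by decide)
  have e5 : D.Tz wPPH = D.Tz (W .h .h .h .pt) := Tz_eq_of_A1 D h1 _ _ wPPH_efree W_hhhp_efree (by decide)
  have e6 : D.Tz wPPP = D.Tz (W .h .h .pt .pt) := Tz_eq_of_A1 D h1 _ _ wPPP_efree W_hhpp_efree (by decide)
  have e7 : D.Tz wPPPH = D.Tz (W .h .pt .pt .pt) := Tz_eq_of_A1 D h1 _ _ wPPPH_efree W_hppp_efree (by decide)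
  refine ⟨e1 ▸ q1_law h hh D hA h1, e2 ▸ q2_law h hh D hA h1, e3 ▸ q3_law h hh D hA h1, e4 ▸ q4_law h hh D hA h1,
    e5 ▸ q5_law h hh D hA h1, e6 ▸ q6_law h hh D hA h1, e7 ▸ q7_law h hh D hA h1, q8_law h hh D hA, ?_, ?_⟩
  · rw [e4']; exact (mu_law h hh D hA h1).1
  · rw [e4']; exact (mu_law h hh D hA h1).2

theorem chargeLattice_six : ChargeLattice 6 := chargeLattice_holds 6 ⟨3, by norm_num⟩
theorem chargeLattice_fourteen : ChargeLattice 14 := chargeLattice_holds 14 ⟨7, by norm_num⟩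
theorem chargeLattice_sixteen : ChargeLattice 16 := chargeLattice_holds 16 ⟨8, by norm_num⟩

/-! ## §8 Corollaries for μ: `μ ∈ 16ℤ[i]`, `Re μ ≡ Im μ (mod 32)`, `|μ|² ≥ 512` -/

theorem mu_sixteen (h : ℤ) (hh : (2 : ℤ) ∣ h) (D : Design) (hA : D.OnAlphabet h) (h1 : D.A1) :
    (16 : ℤ) ∣ D.mu.re ∧ (16 : ℤ) ∣ D.mu.im ∧ (32 : ℤ) ∣ D.mu.re - D.mu.im := by
  obtain ⟨_, _, _, h4, _, _, _, _, hre, him⟩ := chargeLattice_holds h hh D hA h1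
  obtain ⟨a, ha⟩ := h4
  obtain ⟨b, hb⟩ := hre
  obtain ⟨c, hc⟩ := him
  exact ⟨⟨a - 2 * b, by linarith⟩, ⟨a - 2 * c, by linarith⟩, ⟨c - b, by linarith⟩⟩

/-- The 2-adic μ-law of `TwoAdicMuLaw` (`4 ∣ μ`) is two powers of `1+i` short: `16 ∣ μ` in `ℤ[i]`. -/
theorem sixteen_dvd_mu (h : ℤ) (hh : (2 : ℤ) ∣ h) (D : Design) (hA : D.OnAlphabet h) (h1 : D.A1) : (16 : GaussianInt) ∣ D.mu := by
  obtain ⟨⟨a, ha⟩, ⟨b, hb⟩, _⟩ := mu_sixteen h hh D hA h1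
  refine ⟨⟨a, b⟩, ?_⟩
  rw [Zsqrtd.ext_iff]; constructor <;> simp [ha, hb]

/-- Minimal Bloch charge: a nonzero `μ` of an integer (A1)-design at even height has `|μ|² ≥ 512` (`μ ∈ 16(1+i)ℤ[i] ∪ 32ℤ[i]`-type
congruence: `μ = ±16, ±16i` are excluded by `Re μ ≡ Im μ (mod 32)`). -/
theorem mu_norm_ge (h : ℤ) (hh : (2 : ℤ) ∣ h) (D : Design) (hA : D.OnAlphabet h) (h1 : D.A1) (hμ : D.mu ≠ 0) :
    512 ≤ D.mu.re ^ 2 + D.mu.im ^ 2 := by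
  obtain ⟨⟨a, ha⟩, ⟨b, hb⟩, ⟨c, hc⟩⟩ := mu_sixteen h hh D hA h1
  have hab : (a, b) ≠ (0, 0) := by
    intro h0
    simp only [Prod.mk.injEq] at h0
    apply hμ; rw [Zsqrtd.ext_iff]; refine ⟨?_, ?_⟩ <;> simp [ha, hb, h0.1, h0.2]
  have key : a ^ 2 + b ^ 2 = 2 * (c ^ 2 + (b + c) ^ 2) := by
    have e : a = b + 2 * c := by linarith
    rw [e]; ring
  have pos : 1 ≤ c ^ 2 + (b + c) ^ 2 := by
    by_contra hneg
    have hc2 : c ^ 2 = 0 := by nlinarith [sq_nonneg c, sq_nonneg (b + c)]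
    have hbc2 : (b + c) ^ 2 = 0 := by nlinarith [sq_nonneg c, sq_nonneg (b + c)]
    have hc0 : c = 0 := (pow_eq_zero_iff two_ne_zero).mp hc2
    have hbc0 : b + c = 0 := (pow_eq_zero_iff two_ne_zero).mp hbc2
    have hb0 : b = 0 := by linarith
    have ha0 : a = 0 := by linarith
    exact hab (by rw [ha0, hb0])
  rw [ha, hb]; nlinarith [key, pos]

/-- PARITY COUPLING of the top real charge and the Bloch charge: `q₄/8 ≡ Re μ/16 ≡ Im μ/16 (mod 2)`.  In particular a design with NO
Bloch charge (`μ = 0`) has `q₄ ∈ 16ℤ` … -/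
theorem q4_sixteen_of_mu_zero (h : ℤ) (hh : (2 : ℤ) ∣ h) (D : Design) (hA : D.OnAlphabet h) (h1 : D.A1) (hμ : D.mu = 0) :
    (16 : ℤ) ∣ D.Tz wPP := by
  obtain ⟨_, _, _, _, _, _, _, _, hre, _⟩ := chargeLattice_holds h hh D hA h1
  have h32 : (32 : ℤ) ∣ 2 * D.Tz wPP := by simpa [hμ] using hre
  have e : (32 : ℤ) = 2 * 16 := by norm_num
  rw [e] at h32
  exact (mul_dvd_mul_iff_left (by norm_num : (2 : ℤ) ≠ 0)).mp h32

/-- … and an integer (A1)-design whose top charge `q₄` is an ODD multiple of 8 carries a NONZERO Bloch charge (`|μ|² ≥ 512`). -/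
theorem mu_ne_zero_of_q4 (h : ℤ) (hh : (2 : ℤ) ∣ h) (D : Design) (hA : D.OnAlphabet h) (h1 : D.A1) (hq : ¬ (16 : ℤ) ∣ D.Tz wPP) :
    D.mu ≠ 0 := fun hμ => hq (q4_sixteen_of_mu_zero h hh D hA h1 hμ)

/-- PURELY IMAGINARY (or purely real) Bloch charge: if `Re μ = 0` then `32 ∣ Im μ` and `16 ∣ q₄` — so among integer (A1)-designs with
`Re μ = 0` (all designs of record: S′, S131, M72, MINMU-A∕B∕C) a nonzero `μ` has `|μ| ≥ 32`, and the MINMU record `μ = ±32i` is OPTIMAL in that class. -/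
theorem mu_law_of_re_zero (h : ℤ) (hh : (2 : ℤ) ∣ h) (D : Design) (hA : D.OnAlphabet h) (h1 : D.A1) (hre : D.mu.re = 0) :
    (32 : ℤ) ∣ D.mu.im ∧ (16 : ℤ) ∣ D.Tz wPP := by
  obtain ⟨_, _, _, _, _, _, _, _, h32, _⟩ := chargeLattice_holds h hh D hA h1
  obtain ⟨_, _, hdiff⟩ := mu_sixteen h hh D hA h1
  rw [hre] at h32 hdiff
  refine ⟨?_, ?_⟩
  · have : (32 : ℤ) ∣ -(0 - D.mu.im) := (dvd_neg).mpr hdiff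
    simpa using this
  · have e : (32 : ℤ) = 2 * 16 := by norm_num
    rw [sub_zero, e] at h32
    exact (mul_dvd_mul_iff_left (by norm_num : (2 : ℤ) ≠ 0)).mp h32

/-- Same with `Im μ = 0`. -/
theorem mu_law_of_im_zero (h : ℤ) (hh : (2 : ℤ) ∣ h) (D : Design) (hA : D.OnAlphabet h) (h1 : D.A1) (him : D.mu.im = 0) :
    (32 : ℤ) ∣ D.mu.re ∧ (16 : ℤ) ∣ D.Tz wPP := by
  obtain ⟨_, _, _, _, _, _, _, _, _, h32⟩ := chargeLattice_holds h hh D hA h1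
  obtain ⟨_, _, hdiff⟩ := mu_sixteen h hh D hA h1
  rw [him] at h32 hdiff
  refine ⟨by simpa using hdiff, ?_⟩
  have e : (32 : ℤ) = 2 * 16 := by norm_num
  rw [sub_zero, e] at h32
  exact (mul_dvd_mul_iff_left (by norm_num : (2 : ℤ) ≠ 0)).mp h32

end Summit.HodgeConjecture.HodgeConjecture.Cruxes.BlochSeedDiscOne.ChargeLatticeLaw
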